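import Summits.QuantumFields.YangMills.Theorems.F4SubCurvatureDoorSubCurvatureClauseLatticeToAxisTools
import HarnessLib

/-!
# Route `F4SubCurvatureDoor`, crux `SubCurvatureClause` ⟨stmt-QuantumFields-23763⟩ — LATTICE TO AXIS: on-axis lattice windows bound the
# limit kernel on the time axis

Helper file (`--supports stmt-QuantumFields-23763 --as helper`; free-hands seat `ym-line-frs-p2` g19).  Definition-free, 0 sorry, standard
axioms.  It proves the soft stub `LatticeToAxis` of the crux idea «rp-moebius-ladder» (ideator ym-idea-3 g24, HOME `g24/Sketch.lean` :107–123,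
evidence on ⟨23763⟩) in the letter agreed on the cell bus (2026-08-29T22:27:46Z, easings (a) `0 ≤ B` and (c) the window hypothesis bounds BOTH
orders of the reflected pair): under the door's hypotheses, if eventually along the subsequence the on-axis lattice couplings
`(2t)⁸ · lCC(Q^θ, Q, 2t)` and `(2t)⁸ · lCC(Q, Q^θ, 2t)` (`lCC = latticeConnectedCorr` on the torus `2L_k+1`, `Q = r.curvature.F`,
`Q^θ = r.curvature.timeReflect.F`) are `≤ B` at every lattice time `2t` with `2t·a_k ∈ [u(1−θ), u(1+θ)]`, then the continuous representing
kernel obeys `u⁸ |K(u e₀)| ≤ (1+θ)⁸/(1−θ)⁸ · B`.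

* tools (✓`…SubCurvatureClauseLatticeToAxisTools`): `abs_le_of_local_density_bound` (local pointwise-from-density), `torusMoment_two_eq_cov`
  (the two-point weight is `Cov(Q_0, Q_{x₀−x₁})`), `abs_cov_le_of_axis_window` (axis domination + window ⇒ `|Cov| ≤ B/(n−1)⁸`);
* ★ `latticeToAxis_of_axisDomination` (§3): the stub, GIVEN the axis-domination statement (spelled verbatim as the consequent of
  ✓`AxisDominationOfForm`; this file does not import `Theorems/PencilRigidityCurvatureKernelBoundAxisDominationOfForm.lean`, whose olean is not
  served on the hub at the time of writing — the one-line unconditional closer `latticeToAxis := latticeToAxis_of_axisDomination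
  (AxisDominationOfForm OddTorusCovCauchySchwarz)` is filed separately): test functions supported near `u e₀` in the difference variable see
  only lattice pairs with time separation `n`, `|a_k n − u| ≤ θu/2`, so for `a_k ≤ θu/2` both `2⌈n/2⌉ a_k`, `2⌊n/2⌋ a_k` lie in the window; the
  lattice distributions are then dominated by `B a_k⁸/(u(1−θ))⁸ ×` Riemann sums of `‖F‖`, the limit functional by `B/(u(1−θ))⁸ ∫‖F‖`, and
  §1 concludes.

[cite: OsterwalderSeiler1978, §2] (lattice reflection positivity, axis domination); [folklore; Glimm–Jaffe 1987 §6.1] (Riemann sums of lattice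
distributions).

HONEST LABEL: a soft stub; the crux content ON the axis (`MoebiusRow`, `CrossoverDecay` of the card) is untouched; ⟨23763⟩, ⟨23036⟩ open; the
Yang–Mills mass gap is NOT proved; no summit is proved by a line.
-/

set_option autoImplicit false

noncomputable section

open scoped SchwartzMap BigOperators ContDiff
open MeasureTheory Filter Topology Metric Set
open Literature.MathematicalPhysics.QuantumFieldTheory Literature.MathematicalPhysics.QuantumLattice
open Literature.MathematicalPhysics.AQFT
open Literature.Probability.LatticeModels (box Site mem_box)
open Summit.QuantumFields.YangMills.Cruxes.OSLegsFromFemtoAndGap.DlrCollarTransfer (dens torusE MomentBounds6)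
open Summit.QuantumFields.YangMills.Cruxes.OSLegsAtWeakCouplingC.Sketch (tendsto_riemann_sum)
open Summit.QuantumFields.YangMills.Theorems.OSLegsFromFemtoAndGap
open Summit.QuantumFields.YangMills.Theorems.ROT (IsLegScheme OffDiagLimitAlong)
open Summit.QuantumFields.YangMills.Theorems.NPointIsotropy.Negative (E4)
open Summit.QuantumFields.YangMills.Theorems.F4SubCurvatureDoorSubCurvatureClauseLatticeToAxisTools
  (abs_le_of_local_density_bound torusMoment_two_eq_cov abs_cov_le_of_axis_window)

namespace Summit.QuantumFields.YangMills.Theorems.F4SubCurvatureDoorSubCurvatureClauseLatticeToAxis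

/-! ## §3 ★ Lattice to axis -/

/-- Time component of the scaled lattice difference vector minus `u e₀`. [bookkeeping] -/
theorem smul_siteToE_sub_sub_single_apply_zero (a u : ℝ) (x₀ x₁ : Site 4) :
    (a • siteToE x₀ - a • siteToE x₁ - EuclideanSpace.single (0 : Fin 4) u) 0 = a * (((x₀ - x₁) 0 : ℤ) : ℝ) - u := by
  simp only [PiLp.sub_apply, PiLp.smul_apply, siteToE_apply, PiLp.single_apply, smul_eq_mul, Pi.sub_apply, Int.cast_sub,
    if_true]
  ring

/-- ★ **LATTICE TO AXIS, given axis domination** — the soft stub `LatticeToAxis` of the crux idea «rp-moebius-ladder» (ym-idea-3 g24; letter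
agreed 2026-08-29T22:27Z: `0 ≤ B`, two-sided axis window), CONDITIONAL on the axis-domination statement `hAD` (spelled verbatim as the consequent
of the tree theorem ✓`CurvatureKernel.AxisDominationOfForm`, which holds by ✓`OddTorusCovCauchySchwarz`; the unconditional one-liner is filed in
a separate file importing that module).  Under the door's hypotheses, an eventual bound `B` along the subsequence on BOTH on-axis lattice couplings
`(2t)⁸·lCC(Q^θ,Q,2t)`, `(2t)⁸·lCC(Q,Q^θ,2t)` at the lattice times `2t` with `2t·a_k ∈ [u(1−θ), u(1+θ)]` bounds the continuous representing
kernel on the time axis: `u⁸ |K(u e₀)| ≤ (1+θ)⁸/(1−θ)⁸ · B`. [cite: OsterwalderSeiler1978, §2] -/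
theorem latticeToAxis_of_axisDomination
    (hAD : ∀ (G : Type) [Group G] [TopologicalSpace G] [IsTopologicalGroup G] [CompactSpace G] [MeasurableSpace G] [BorelSpace G]
      (r : LatticeRep G) (β : ℝ), 0 ≤ β → ∀ (L : ℕ) (z : Site 4) (n : ℕ), z 0 = n → 3 ≤ n → n ≤ L →
      0 ≤ latticeConnectedCorr r.ρ β (2 * L + 1) r.curvature.timeReflect.F r.curvature.F (2 * (n / 2)) ∧
      0 ≤ latticeConnectedCorr r.ρ β (2 * L + 1) r.curvature.F r.curvature.timeReflect.F (2 * ((n + 1) / 2)) ∧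
      ((∫ U, r.curvature.F (torusLift (2 * L + 1) U) * r.curvature.F (configShift (-z) (torusLift (2 * L + 1) U))
            ∂(wilsonMeasure r.ρ β : MeasureTheory.Measure (GaugeConfig 4 (2 * L + 1) G))) -
          (∫ U, r.curvature.F (torusLift (2 * L + 1) U) ∂(wilsonMeasure r.ρ β : MeasureTheory.Measure (GaugeConfig 4 (2 * L + 1) G))) *
          (∫ U, r.curvature.F (configShift (-z) (torusLift (2 * L + 1) U))
            ∂(wilsonMeasure r.ρ β : MeasureTheory.Measure (GaugeConfig 4 (2 * L + 1) G)))) ^ 2 ≤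
        latticeConnectedCorr r.ρ β (2 * L + 1) r.curvature.F r.curvature.timeReflect.F (2 * ((n + 1) / 2)) *
          latticeConnectedCorr r.ρ β (2 * L + 1) r.curvature.timeReflect.F r.curvature.F (2 * (n / 2))) :
    ∀ (G : Type) [Group G] [TopologicalSpace G] [IsTopologicalGroup G] [CompactSpace G],
      IsCompactSimpleLieGroup G →
      letI : MeasurableSpace G := borel G
      haveI : BorelSpace G := ⟨rfl⟩
      ∀ (r : LatticeRep G) (a : ℝ → ℝ), (∀ β, 0 < a β) → Tendsto a atTop (nhds 0) → MomentBounds6 G r a →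
        ∀ sch : SpeciesScheme (YMSpecies G), IsLegScheme a sch → ∀ φ : ℕ → ℕ, Tendsto φ atTop atTop →
        ∀ S₁ : SchwingerFamily E4, OffDiagLimitAlong r sch φ S₁ →
        ∀ K : E4 → ℝ, ContinuousOn K {x : E4 | x ≠ 0} →
        (∀ F : 𝓢((Fin 2 → E4), ℂ), IsOffDiagonal F → HasCompactSupport (F : (Fin 2 → E4) → ℂ) →
          Integrable (fun x : Fin 2 → E4 => (K (x 0 - x 1) : ℂ) * F x) ∧
            S₁ 2 F = ∫ x : Fin 2 → E4, (K (x 0 - x 1) : ℂ) * F x) →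
        ∀ (u θ B : ℝ), 0 < u → 0 < θ → θ < 1 → 0 ≤ B →
          (∀ᶠ k in atTop, ∀ t : ℕ, u * (1 - θ) ≤ 2 * t * sch.a (φ k) → 2 * t * sch.a (φ k) ≤ u * (1 + θ) →
            ((2 * t : ℕ) : ℝ) ^ 8 * latticeConnectedCorr r.ρ (sch.β (φ k)) (2 * sch.L (φ k) + 1)
                r.curvature.timeReflect.F r.curvature.F (2 * t) ≤ B ∧
            ((2 * t : ℕ) : ℝ) ^ 8 * latticeConnectedCorr r.ρ (sch.β (φ k)) (2 * sch.L (φ k) + 1)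
                r.curvature.F r.curvature.timeReflect.F (2 * t) ≤ B) →
          u ^ 8 * |K (EuclideanSpace.single 0 u)| ≤ (1 + θ) ^ 8 / (1 - θ) ^ 8 * B := by
  intro G _ _ _ _ hG
  letI : MeasurableSpace G := borel G
  haveI : BorelSpace G := ⟨rfl⟩
  intro r a hapos ha0 hMB sch hsch φ hφ S₁ hS₁ K hKc hrep u θ B hu hθ hθ1 hB0 hwin
  classical
  obtain ⟨-, -, hranges⟩ := hsch
  obtain ⟨-, -, hconv⟩ := hS₁
  -- the scheme along `φ`
  set as : ℕ → ℝ := fun k => sch.a (φ k) with has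
  set βs : ℕ → ℝ := fun k => sch.β (φ k) with hβs
  set Ls : ℕ → ℕ := fun k => sch.L (φ k) with hLs
  have hapos' : ∀ k, 0 < as k := fun k => sch.a_pos _
  have ha0' : Tendsto as atTop (𝓝 0) := sch.tendsto_a.comp hφ
  have haL : Tendsto (fun k => as k * (Ls k : ℝ)) atTop atTop := sch.tendsto_L.comp hφ
  -- constants: the localisation radius `ρ = θu/2` and the density constant `B' = B/(u(1−θ))⁸`
  have h1θ : 0 < 1 - θ := by linarith
  have huθ : 0 < u * (1 - θ) := mul_pos hu h1θ
  set ρ : ℝ := θ * u / 2 with hρ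
  have hρ0 : 0 < ρ := by positivity
  have hρu : ρ < u / 2 := by
    rw [hρ]
    have : θ * u < 1 * u := mul_lt_mul_of_pos_right hθ1 hu
    linarith
  set B' : ℝ := B / (u * (1 - θ)) ^ 8 with hB'
  have hB'0 : 0 ≤ B' := div_nonneg hB0 (pow_nonneg huθ.le 8)
  have hx0 : (EuclideanSpace.single (0 : Fin 4) u : E4) ≠ 0 := by
    rw [Ne, PiLp.single_eq_zero_iff]; exact hu.ne'
  -- STEP 1: the local density bound `‖S₁ 2 F‖ ≤ B' ∫‖F‖` for test functions localised at `u e₀`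
  have hdens : ∀ F : 𝓢((Fin 2 → E4), ℂ), HasCompactSupport (F : (Fin 2 → E4) → ℂ) →
      tsupport (F : (Fin 2 → E4) → ℂ) ⊆ {y | y 0 - y 1 ∈ closedBall (EuclideanSpace.single (0 : Fin 4) u) ρ} →
        ‖S₁ 2 F‖ ≤ B' * ∫ x, ‖F x‖ := by
    intro F hFc hFs
    -- difference vectors on the support have time component `≥ u − ρ > 0`; in particular `F` is off-diagonal
    have htime_of_mem : ∀ y ∈ tsupport (F : (Fin 2 → E4) → ℂ), u - ρ ≤ (y 0 - y 1) 0 := by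
      intro y hy
      have h1 : ‖y 0 - y 1 - EuclideanSpace.single 0 u‖ ≤ ρ := by
        have := hFs hy; rwa [mem_setOf_eq, mem_closedBall, dist_eq_norm] at this
      have h2 := (PiLp.norm_apply_le (y 0 - y 1 - EuclideanSpace.single (0 : Fin 4) u) 0).trans h1
      rw [Real.norm_eq_abs, PiLp.sub_apply, PiLp.single_apply, if_pos rfl] at h2
      have := (abs_le.1 h2).1
      linarith
    have hFoff : IsOffDiagonal F := by
      refine IsOffDiagonal.of_tsupport_subset fun y hy hco => ?_
      obtain ⟨i, j, hij, hyij⟩ := (mem_coincidenceLocus y).1 hco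
      have h01 : y 0 = y 1 := by
        fin_cases i <;> fin_cases j
        · exact absurd rfl hij
        · exact hyij
        · exact hyij.symm
        · exact absurd rfl hij
      have h := htime_of_mem y hy
      rw [h01, sub_self, PiLp.zero_apply] at h
      linarith
    -- the two limits
    have hlim : Tendsto (fun k => ‖latticeDist r.ρ (βs k) (Ls k) (as k) r.curvature.F
        (wilsonTorusMean r.ρ (βs k) (Ls k) r.curvature.F) 2 F‖) atTop (𝓝 ‖S₁ 2 F‖) :=
      (hconv 2 le_rfl F hFoff).norm
    have hRiem : Tendsto (fun k => as k ^ (4 * 2) *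
        ∑ x ∈ Fintype.piFinset (fun _ : Fin 2 => box 4 (Ls k)), ‖F (fun i => as k • siteToE (x i))‖)
        atTop (𝓝 (∫ y, ‖F y‖)) :=
      tendsto_riemann_sum (fun y => ‖F y‖) F.continuous.norm hFc.norm as Ls hapos' ha0' haL
    -- eventual domination
    have hε : 0 < min (θ * u / 2) (min (u / 6) (1 / (2 * u))) :=
      lt_min hρ0 (lt_min (by positivity) (by positivity))
    have hev : ∀ᶠ k in atTop, ‖latticeDist r.ρ (βs k) (Ls k) (as k) r.curvature.F
        (wilsonTorusMean r.ρ (βs k) (Ls k) r.curvature.F) 2 F‖ ≤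
        B' * (as k ^ (4 * 2) * ∑ x ∈ Fintype.piFinset (fun _ : Fin 2 => box 4 (Ls k)), ‖F (fun i => as k • siteToE (x i))‖) := by
      filter_upwards [hwin, ha0'.eventually (gt_mem_nhds hε)] with k hwk hka
      have hak : 0 < as k := hapos' k
      have ha1 : as k ≤ θ * u / 2 := hka.le.trans (min_le_left _ _)
      have ha2 : as k ≤ u / 6 := (hka.le.trans (min_le_right _ _)).trans (min_le_left _ _)
      have ha3 : as k ≤ 1 / (2 * u) := (hka.le.trans (min_le_right _ _)).trans (min_le_right _ _)
      obtain ⟨hβk, -, -, hLa⟩ := hranges (φ k)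
      -- the weight at the lattice pairs seen by `F`
      have hW : ∀ x : Fin 2 → Site 4, F (fun i => as k • siteToE (x i)) ≠ 0 →
          |torusMoment r.ρ (βs k) (Ls k) r.curvature.F (wilsonTorusMean r.ρ (βs k) (Ls k) r.curvature.F) x| ≤
            B' * as k ^ (4 * 2) := by
        intro x hx
        have hy : (fun i => as k • siteToE (x i)) ∈ tsupport (F : (Fin 2 → E4) → ℂ) :=
          subset_tsupport _ (Function.mem_support.2 hx)
        set z : Site 4 := x 0 - x 1 with hz
        -- `|a_k z₀ − u| ≤ ρ`
        have hzt : |as k * ((z 0 : ℤ) : ℝ) - u| ≤ ρ := by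
          have h1 : ‖as k • siteToE (x 0) - as k • siteToE (x 1) - EuclideanSpace.single 0 u‖ ≤ ρ := by
            have := hFs hy; rwa [mem_setOf_eq, mem_closedBall, dist_eq_norm] at this
          have h2 := (PiLp.norm_apply_le (as k • siteToE (x 0) - as k • siteToE (x 1) - EuclideanSpace.single (0 : Fin 4) u) 0).trans h1
          rwa [Real.norm_eq_abs, smul_siteToE_sub_sub_single_apply_zero] at h2
        obtain ⟨hzl, hzu⟩ := abs_le.1 hzt
        -- `z₀ = n ∈ ℕ`, `3 ≤ n ≤ L_k`
        have hz0pos : (0 : ℝ) < ((z 0 : ℤ) : ℝ) := by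
          by_contra h
          have h' : as k * ((z 0 : ℤ) : ℝ) ≤ 0 := mul_nonpos_of_nonneg_of_nonpos hak.le (not_lt.1 h)
          linarith
        have hz0nn : 0 ≤ z 0 := by exact_mod_cast hz0pos.le
        obtain ⟨n, hn⟩ : ∃ n : ℕ, z 0 = n := ⟨(z 0).toNat, (Int.toNat_of_nonneg hz0nn).symm⟩
        have hnr : ((z 0 : ℤ) : ℝ) = (n : ℝ) := by rw [hn]; rfl
        rw [hnr] at hzl hzu hz0pos
        have hn3 : 3 ≤ n := by
          have h6 : 6 * as k ≤ u := by linarith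
          have : (2 : ℝ) < n := by
            by_contra hc
            have hc' : (n : ℝ) ≤ 2 := not_lt.1 hc
            have : as k * n ≤ as k * 2 := mul_le_mul_of_nonneg_left hc' hak.le
            linarith
          exact_mod_cast this
        have hnL : n ≤ Ls k := by
          have h1 : as k * n ≤ 2 * u := by linarith
          have h2 : (n : ℝ) ≤ 2 * u / as k := by rw [le_div_iff₀ hak]; linarith
          have h3 : 2 * u / as k ≤ (as k)⁻¹ * (as k)⁻¹ := by
            rw [div_le_iff₀ hak]
            have : 2 * u * as k ≤ 1 := by
              have := ha3; rw [le_div_iff₀ (by positivity)] at this; linarith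
            calc 2 * u = 2 * u * as k * (as k)⁻¹ := by field_simp
              _ ≤ 1 * (as k)⁻¹ := mul_le_mul_of_nonneg_right this (inv_nonneg.2 hak.le)
              _ = (as k)⁻¹ * (as k)⁻¹ * as k := by field_simp
          have : (n : ℝ) ≤ (Ls k : ℝ) := h2.trans (h3.trans hLa)
          exact_mod_cast this
        -- the two window times `2⌈n/2⌉`, `2⌊n/2⌋ ∈ [n−1, n+1]`
        have hwindow : ∀ t : ℕ, n - 1 ≤ 2 * t → 2 * t ≤ n + 1 →
            u * (1 - θ) ≤ 2 * t * sch.a (φ k) ∧ 2 * t * sch.a (φ k) ≤ u * (1 + θ) := by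
          intro t ht1 ht2
          have ht1' : (n : ℝ) - 1 ≤ ((2 * t : ℕ) : ℝ) := by
            have h' : ((n - 1 : ℕ) : ℝ) ≤ ((2 * t : ℕ) : ℝ) := by exact_mod_cast ht1
            rwa [Nat.cast_sub (by omega), Nat.cast_one] at h'
          have ht2' : ((2 * t : ℕ) : ℝ) ≤ (n : ℝ) + 1 := by exact_mod_cast ht2
          have hc : ((2 * t : ℕ) : ℝ) = 2 * (t : ℝ) := by push_cast; ring
          constructor
          · have : (as k) * ((n : ℝ) - 1) ≤ as k * ((2 * t : ℕ) : ℝ) := mul_le_mul_of_nonneg_left ht1' hak.le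
            rw [hc] at this
            have h4 : u * (1 - θ) ≤ as k * ((n : ℝ) - 1) := by nlinarith
            calc u * (1 - θ) ≤ as k * ((n : ℝ) - 1) := h4
              _ ≤ as k * (2 * (t : ℝ)) := this
              _ = 2 * t * sch.a (φ k) := by rw [has]; ring
          · have : as k * ((2 * t : ℕ) : ℝ) ≤ as k * ((n : ℝ) + 1) := mul_le_mul_of_nonneg_left ht2' hak.le
            rw [hc] at this
            have h4 : as k * ((n : ℝ) + 1) ≤ u * (1 + θ) := by nlinarith
            calc 2 * (t : ℝ) * sch.a (φ k) = as k * (2 * (t : ℝ)) := by rw [has]; ring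
              _ ≤ as k * ((n : ℝ) + 1) := this
              _ ≤ u * (1 + θ) := h4
        obtain ⟨hl1, hu1⟩ := hwindow ((n + 1) / 2) (by omega) (by omega)
        obtain ⟨hl2, hu2⟩ := hwindow (n / 2) (by omega) (by omega)
        obtain ⟨-, hw1⟩ := hwk ((n + 1) / 2) hl1 hu1
        obtain ⟨hw2, -⟩ := hwk (n / 2) hl2 hu2
        obtain ⟨hpos2, -, hsq⟩ := hAD G r (βs k) hβk (Ls k) z n hn hn3 hnL
        have hcov := abs_cov_le_of_axis_window r (βs k) (Ls k) z n hn3 hB0 hpos2 hsq hw1 hw2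
        rw [torusMoment_two_eq_cov, ← hz]
        refine hcov.trans ?_
        -- `B/(n−1)⁸ ≤ B' a_k⁸` since `a_k (n − 1) ≥ u(1−θ)`
        have hm : u * (1 - θ) ≤ as k * ((n : ℝ) - 1) := by nlinarith
        have hm0 : 0 < (n : ℝ) - 1 := by
          have : (3 : ℝ) ≤ n := by exact_mod_cast hn3
          linarith
        rw [show (4 * 2 : ℕ) = 8 by norm_num, hB', div_mul_eq_mul_div, div_le_div_iff₀ (pow_pos hm0 8) (pow_pos huθ 8)]
        calc B * (u * (1 - θ)) ^ 8 ≤ B * (as k * ((n : ℝ) - 1)) ^ 8 :=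
              mul_le_mul_of_nonneg_left (pow_le_pow_left₀ huθ.le hm 8) hB0
          _ = B * as k ^ 8 * ((n : ℝ) - 1) ^ 8 := by ring
      -- sum over the torus
      rw [latticeDist_apply]
      refine (norm_sum_le _ _).trans ?_
      calc ∑ x ∈ Fintype.piFinset (fun _ : Fin 2 => box 4 (Ls k)),
            ‖((torusMoment r.ρ (βs k) (Ls k) r.curvature.F
                (wilsonTorusMean r.ρ (βs k) (Ls k) r.curvature.F) x : ℝ) : ℂ) *
              F (fun i => as k • siteToE (x i))‖
          ≤ ∑ x ∈ Fintype.piFinset (fun _ : Fin 2 => box 4 (Ls k)),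
            B' * as k ^ (4 * 2) * ‖F (fun i => as k • siteToE (x i))‖ := by
            refine Finset.sum_le_sum fun x _ => ?_
            rw [norm_mul, Complex.norm_real, Real.norm_eq_abs]
            by_cases hx : F (fun i => as k • siteToE (x i)) = 0
            · simp [hx]
            · exact mul_le_mul_of_nonneg_right (hW x hx) (norm_nonneg _)
        _ = B' * (as k ^ (4 * 2) *
            ∑ x ∈ Fintype.piFinset (fun _ : Fin 2 => box 4 (Ls k)), ‖F (fun i => as k • siteToE (x i))‖) := by
            rw [Finset.mul_sum, Finset.mul_sum]
            exact Finset.sum_congr rfl fun x _ => by ring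
    exact le_of_tendsto_of_tendsto hlim (hRiem.const_mul _) hev
  -- STEP 2: the local pointwise lemma
  have hK : |K (EuclideanSpace.single 0 u)| ≤ B' :=
    abs_le_of_local_density_bound K hKc (S₁ 2) hrep hx0 hρ0 hdens
  -- STEP 3: constants
  have h1θ8 : 0 < (1 - θ) ^ 8 := pow_pos h1θ 8
  calc u ^ 8 * |K (EuclideanSpace.single 0 u)| ≤ u ^ 8 * B' := mul_le_mul_of_nonneg_left hK (by positivity)
    _ = B / (1 - θ) ^ 8 := by
        rw [hB', mul_pow]
        field_simp
    _ = 1 / (1 - θ) ^ 8 * B := by ring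
    _ ≤ (1 + θ) ^ 8 / (1 - θ) ^ 8 * B := by
        refine mul_le_mul_of_nonneg_right (div_le_div_of_nonneg_right ?_ h1θ8.le) hB0
        exact one_le_pow₀ (by linarith)

end Summit.QuantumFields.YangMills.Theorems.F4SubCurvatureDoorSubCurvatureClauseLatticeToAxis

end
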